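import Literature.Analysis.FluidPDE.SobolevWholeSpace
import Literature.Analysis.FluidPDE.SteadyLiouvilleNineHalvesSolenoidal
import Literature.Analysis.FluidPDE.LerayProfileRegularity
import Literature.Analysis.FluidPDE.NSViscosityRescaling
import Literature.Analysis.FluidPDE.LerayHopfH1Test
import HarnessLib

/-!
# Steady Navier–Stokes solutions on `ℝ³` in `L^p ∩ Ḣ¹`, `p ≤ 9/2`, are trivial
# (Galdi's `L^{9/2}` Liouville criterion through the Sobolev embedding)

Analysis/FluidPDE proofs file (theorems only: no definitions, no named facts). **Proved:** for
`ν > 0`, a `C²` solution `(U, P)` of the steady system `−νΔU + (U·∇)U + ∇P = 0`, `div U = 0` on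
`ℝ³` (`IsLerayProfile ν 0 U P`) with `∫ |∇U|² < ∞` and `U ∈ L^q(ℝ³)` for some `2 ≤ q ≤ 9/2` is
`≡ 0` (`steadyNS_eq_zero_of_memLp_of_dirichlet`). Route: `U ∈ C^∞` (Tsai 1998, p. 33;
`IsLerayProfile.contDiff_velocity_infty`); Gagliardo–Nirenberg–Sobolev WITHOUT compact support for
`C¹` fields in SOME `L^q`, `p ≤ q < p*` (Evans, *PDE*, §5.6.1, truncation proof of Thm. 2; the
tree's unprimed `eLpNorm_le_eLpNorm_fderiv_of_eq_of_eLpNorm_lt_top` asks `q = p`) gives `U ∈ L⁶`;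
Lebesgue interpolation gives `U ∈ L^{9/2}`; after rescaling to `ν = 1` the tree's pressure-free
proof of Galdi's Thm. X.9.5 (`SteadyLiouvilleL9half.integral_gradSq_eq_zero`) gives `∇U ≡ 0`, and
a constant in `L^{9/2}(ℝ³)` is `0` — no decay hypothesis `U → 0` (unlike the named fact
`galdi_liouville_nineHalves`).

**Scope note (why this file exists).** D. Chae, J. Funct. Anal. 258 (2010) 2865–2883, Thm. 1.4
(= arXiv:0711.1113, Thm. 3.1; the tree's named fact `chae2010_typeII_asymptoticallySelfSimilar`,
stated for all `p ∈ [3, ∞)`) ends its proof (p. 6 of the held text) with: "`V̄` is a stationary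
solution of the Navier–Stokes equations … In the case `V̄ ∈ Ḣ¹ ∩ L^p(ℝ³)`, we easily obtain from
(1.27) that `∫ |∇V̄|² = 0`, which implies `V̄ = 0`." That step is the energy identity for a steady
solution in `L^p ∩ Ḣ¹(ℝ³)`: a theorem for `p ≤ 9/2` — the one proved here — while for `p > 9/2` the
cut-off flux `R⁻¹∫_{R<|x|<2R}|V̄|³ ≲ R^{2−9/p}‖V̄‖³_{L^p}` no longer decays and the step is the open
Liouville problem for steady D-solutions (tree label `SteadyDSolutionLiouvilleProblem`). The file
records the provable range of that printed step by name; it asserts nothing about the named fact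
itself and nothing about Navier–Stokes blow-up.

## References

* G. P. Galdi, *An Introduction to the Mathematical Theory of the Navier–Stokes Equations.
  Steady-State Problems*, 2nd ed., Springer 2011, Thm. X.9.5 (p. 729). [Galdi2011]
* D. Chae, J. Funct. Anal. 258 (2010) 2865–2883, doi:10.1016/j.jfa.2010.02.006, Thm. 1.4 and its
  proof; = arXiv:0711.1113, Thm. 3.1. [Chae2010]
* L. C. Evans, *Partial Differential Equations*, 2nd ed. (2010), §5.6.1, Thm. 1–2. [Evans2010]
* J. C. Robinson, J. L. Rodrigo, W. Sadowski, *The three-dimensional Navier–Stokes equations*,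
  CUP 2016, Thm. 1.5. [RobinsonRodrigoSadowski2016]
* T.-P. Tsai, Arch. Ration. Mech. Anal. 143 (1998) 29–51, p. 33. [Tsai1998]
-/

noncomputable section

open MeasureTheory Set Function Filter Metric Topology
open scoped NNReal ENNReal Laplacian InnerProductSpace

namespace Literature.Analysis.FluidPDE

section Generic
variable {E : Type*} [NormedAddCommGroup E] [InnerProductSpace ℝ E]

/-- The cut-off `χ_R` (`cutoff R`, `= 0` on `‖x‖ ≥ 2R`) has zero derivative at every point with
`‖x‖ > 2R` (general `E`; the tree's `fderiv_cutoff_eq_zero_of_two_mul_lt` of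
`KatoLocalLerayPressure` is the `ℝ³` case). [folklore] -/
private theorem cutoff_fderiv_vanishes_off_twoBall {R : ℝ} (hR : 0 < R) {x : E} (hx : 2 * R < ‖x‖) :
    fderiv ℝ (cutoff R) x = 0 := by
  have h : (cutoff (E := E) R) =ᶠ[𝓝 x] fun _ => (0 : ℝ) := by
    filter_upwards [(isOpen_lt continuous_const continuous_norm).mem_nhds hx] with y hy
    exact cutoff_eq_zero hR (le_of_lt hy)
  rw [h.fderiv_eq]
  exact fderiv_const_apply 0

/-- **Hölder's inequality on a set of finite measure**: if `support f ⊆ s` and `p ≤ q` then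
`‖f‖_{L^p(μ)} ≤ μ(s)^{1/p − 1/q} ‖f‖_{L^q(μ)}` (Hölder's inequality against the indicator of `s`).
[cite: Evans2010, App. B.2 (Hölder's inequality)] -/
theorem eLpNorm_le_measure_rpow_mul_eLpNorm_of_support_subset {α : Type*} [MeasurableSpace α]
    {μ : Measure α} {G : Type*} [NormedAddCommGroup G] {f : α → G}
    (hf : AEStronglyMeasurable f μ) {s : Set α} (hsupp : Function.support f ⊆ s) {p q : ℝ≥0∞}
    (hpq : p ≤ q) :
    eLpNorm f p μ ≤ μ s ^ (1 / p.toReal - 1 / q.toReal) * eLpNorm f q μ := by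
  rw [← eLpNorm_restrict_eq_of_support_subset (μ := μ) (p := p) hsupp, mul_comm]
  refine (eLpNorm_le_eLpNorm_mul_rpow_measure_univ hpq hf.restrict).trans ?_
  rw [Measure.restrict_apply_univ]
  gcongr
  exact Measure.restrict_le_self

end Generic

section GNS
variable {E : Type*} [NormedAddCommGroup E] [InnerProductSpace ℝ E] [FiniteDimensional ℝ E]
  [MeasurableSpace E] [BorelSpace E]
  {F : Type*} [NormedAddCommGroup F] [NormedSpace ℝ F]

/-- **Mixed-norm bound for the derivative of a truncation**: if `‖Dχ_R‖ ≤ C/R` and `1 ≤ p ≤ q`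
then `‖D(χ_R u)‖_{L^p} ≤ ‖Du‖_{L^p} + μ(B̄(0,2R))^{1/p−1/q} (C/R) ‖u‖_{L^q}` (`(Dχ_R) ⊗ u` lives
in `B̄(0, 2R)`, where Hölder trades `L^p` for `L^q`). [cite: Evans2010, §5.6.1 proof of Thm. 2] -/
theorem eLpNorm_fderiv_cutoff_smul_le' (μ : Measure E) {u : E → F} (hu : ContDiff ℝ 1 u)
    {C R : ℝ} (hC0 : 0 ≤ C) (hR : 0 < R) (hC : ∀ x : E, ‖fderiv ℝ (cutoff R) x‖ ≤ C / R)
    {p q : ℝ≥0∞} (hp : 1 ≤ p) (hpq : p ≤ q) :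
    eLpNorm (fderiv ℝ fun y => cutoff R y • u y) p μ ≤
      eLpNorm (fderiv ℝ u) p μ +
        μ (closedBall (0 : E) (2 * R)) ^ (1 / p.toReal - 1 / q.toReal) *
          (ENNReal.ofReal (C / R) * eLpNorm u q μ) := by
  have hLeib : ∀ x, fderiv ℝ (fun y => cutoff R y • u y) x =
      cutoff R x • fderiv ℝ u x + (fderiv ℝ (cutoff R) x).smulRight (u x) := fun x =>
    fderiv_fun_smul (((contDiff_cutoff (n := 1) R).differentiable one_ne_zero) x)
      ((hu.differentiable one_ne_zero) x)
  have hcont₁ : Continuous (fun x => cutoff R x • fderiv ℝ u x) :=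
    (contDiff_cutoff (n := 1) R).continuous.smul (hu.continuous_fderiv one_ne_zero)
  have hmeas₂ : AEStronglyMeasurable (fun x => (fderiv ℝ (cutoff R) x).smulRight (u x)) μ := by
    have e : (fun x => (fderiv ℝ (cutoff R) x).smulRight (u x)) =
        fun x => fderiv ℝ (fun y => cutoff R y • u y) x - cutoff R x • fderiv ℝ u x := by
      funext x; rw [hLeib x]; abel
    rw [e]
    exact ((((contDiff_cutoff (n := 1) R).smul hu).continuous_fderiv one_ne_zero).sub
      hcont₁).aestronglyMeasurable
  have h₁ : eLpNorm (fun x => cutoff R x • fderiv ℝ u x) p μ ≤ eLpNorm (fderiv ℝ u) p μ := by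
    refine eLpNorm_mono fun x => ?_
    rw [norm_smul, Real.norm_eq_abs]
    exact mul_le_of_le_one_left (norm_nonneg _) (abs_cutoff_le_one R x)
  have hsupp : Function.support (fun x => (fderiv ℝ (cutoff R) x).smulRight (u x)) ⊆
      closedBall (0 : E) (2 * R) := by
    intro x hx
    rw [mem_closedBall_zero_iff]
    by_contra hxR
    apply hx
    simp only [cutoff_fderiv_vanishes_off_twoBall hR (not_le.1 hxR)]
    ext v
    simp
  have hgq : eLpNorm (fun x => (fderiv ℝ (cutoff R) x).smulRight (u x)) q μ ≤
      ENNReal.ofReal (C / R) * eLpNorm u q μ := by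
    have hpt : ∀ x, ‖(fderiv ℝ (cutoff R) x).smulRight (u x)‖ ≤ C / R * ‖u x‖ := fun x => by
      rw [ContinuousLinearMap.norm_smulRight_apply]
      exact mul_le_mul_of_nonneg_right (hC x) (norm_nonneg _)
    refine (eLpNorm_mono_real hpt).trans_eq ?_
    have : (fun x => C / R * ‖u x‖) = (C / R) • fun x => ‖u x‖ := rfl
    rw [this, eLpNorm_const_smul, eLpNorm_norm, Real.enorm_eq_ofReal (by positivity)]
  have h₂ := (eLpNorm_le_measure_rpow_mul_eLpNorm_of_support_subset hmeas₂ hsupp hpq).trans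
    (mul_le_mul_of_nonneg_left hgq (by simp))
  have hfun : (fderiv ℝ fun y => cutoff R y • u y) =
      (fun x => cutoff R x • fderiv ℝ u x) + fun x => (fderiv ℝ (cutoff R) x).smulRight (u x) :=
    funext fun x => by rw [Pi.add_apply]; exact hLeib x
  rw [hfun]
  exact (eLpNorm_add_le hcont₁.aestronglyMeasurable hmeas₂ hp).trans (add_le_add h₁ h₂)

variable [FiniteDimensional ℝ F]

/-- **Gagliardo–Nirenberg–Sobolev inequality without compact support, for `u ∈ L^q`.** Let `E`
have dimension `n ≥ 1`, `μ` an additive Haar measure, `1 ≤ p ≤ q`, `p'⁻¹ = p⁻¹ − n⁻¹` and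
`n (1/p − 1/q) < 1` (i.e. `q < p'`); let `u : E → F` be `C¹` with `‖u‖_{L^q(μ)} < ∞`. Then
`‖u‖_{L^{p'}(μ)} ≤ K ‖Du‖_{L^p(μ)}`, `K = SNormLESNormFDerivOfEqConst F μ p` (truncation argument:
GNS for `χ_R u`, error `μ(B̄_{2R})^{1/p−1/q}(C/R)‖u‖_q = O(R^{n/p−n/q−1}) → 0`, Fatou in `L^{p'}`;
the integrability hypothesis only excludes the constants). [cite: Evans2010, §5.6.1 Thm. 1–2] -/
theorem eLpNorm_le_eLpNorm_fderiv_of_eq_of_eLpNorm_lt_top' (μ : Measure E) [μ.IsAddHaarMeasure]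
    {u : E → F} (hu : ContDiff ℝ 1 u) {p p' : ℝ≥0} {q : ℝ≥0∞} (hp : 1 ≤ p) (hpq : (p : ℝ≥0∞) ≤ q)
    (hn : 0 < Module.finrank ℝ E)
    (hp' : (p' : ℝ)⁻¹ = (p : ℝ)⁻¹ - (Module.finrank ℝ E : ℝ)⁻¹)
    (hq : (Module.finrank ℝ E : ℝ) * (1 / (p : ℝ) - 1 / q.toReal) < 1)
    (huq : eLpNorm u q μ < ∞) :
    eLpNorm u p' μ ≤ SNormLESNormFDerivOfEqConst F μ p * eLpNorm (fderiv ℝ u) p μ := by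
  obtain ⟨C, hC0, hC⟩ := exists_norm_fderiv_cutoff_le (E := E)
  set K : ℝ≥0 := SNormLESNormFDerivOfEqConst F μ p with hK
  set d : ℕ := Module.finrank ℝ E with hd
  set a : ℝ := 1 / (p : ℝ) - 1 / q.toReal with ha
  have hp1 : (1 : ℝ≥0∞) ≤ (p : ℝ≥0∞) := by exact_mod_cast hp
  have hptoReal : ((p : ℝ≥0∞)).toReal = (p : ℝ) := ENNReal.coe_toReal p
  have hp0 : (0 : ℝ) < p := lt_of_lt_of_le one_pos (by exact_mod_cast hp)
  have ha0 : 0 ≤ a := by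
    rw [ha, sub_nonneg]
    rcases eq_or_ne q ⊤ with hqt | hqt
    · rw [hqt, ENNReal.toReal_top, div_zero]; positivity
    · refine one_div_le_one_div_of_le hp0 ?_
      have := ENNReal.toReal_mono hqt hpq
      rwa [hptoReal] at this
  set uR : ℕ → E → F := fun n x => cutoff ((n : ℝ) + 1) x • u x with huR
  have hRpos : ∀ n : ℕ, (0 : ℝ) < n + 1 := fun n => by positivity
  have h1 : ∀ n, ContDiff ℝ 1 (uR n) := fun n => (contDiff_cutoff _).smul hu
  have h2 : ∀ n, HasCompactSupport (uR n) := fun n =>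
    (hasCompactSupport_cutoff (hRpos n)).smul_right
  set c : ℕ → ℝ≥0∞ := fun n =>
    μ (closedBall (0 : E) (2 * ((n : ℝ) + 1))) ^ (1 / ((p : ℝ≥0∞)).toReal - 1 / q.toReal) *
      ENNReal.ofReal (C / ((n : ℝ) + 1)) with hc
  have hGNS : ∀ n, eLpNorm (uR n) p' μ ≤ K * (eLpNorm (fderiv ℝ u) p μ + c n * eLpNorm u q μ) :=
    fun n => (eLpNorm_le_eLpNorm_fderiv_of_eq μ (h1 n) (h2 n) hp hn hp').trans <| by
      rw [← hK]
      gcongr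
      have h := eLpNorm_fderiv_cutoff_smul_le' μ hu hC0 (hRpos n) (hC _ (hRpos n)) hp1 hpq
      simpa only [hc, mul_assoc] using h
  have hlim : ∀ x, Tendsto (fun n => uR n x) atTop (𝓝 (u x)) := fun x => by
    simpa [huR] using (tendsto_cutoff_natCast_add_one x).smul_const (u x)
  have hFatou : eLpNorm u p' μ ≤ atTop.liminf fun n => eLpNorm (uR n) p' μ :=
    Lp.eLpNorm_lim_le_liminf_eLpNorm (fun n => (h1 n).continuous.aestronglyMeasurable) u
      (Eventually.of_forall hlim)
  -- `c n = μ(B̄₁)^a · (2(n+1))^{d a} · C/(n+1) → 0` since `d a < 1`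
  have hcoef : Tendsto c atTop (𝓝 0) := by
    have hB1 : μ (closedBall (0 : E) 1) < ⊤ := (isCompact_closedBall (0 : E) 1).measure_lt_top
    have hc_eq : ∀ n : ℕ, c n = ENNReal.ofReal (((2 * ((n : ℝ) + 1)) ^ d) ^ a * (C / ((n : ℝ) + 1)))
        * μ (closedBall (0 : E) 1) ^ a := fun n => by
      simp only [hc]
      rw [hptoReal, ← ha, hd, Measure.addHaar_closedBall' μ (0 : E) (by positivity),
        ENNReal.mul_rpow_of_nonneg _ _ ha0, ENNReal.ofReal_rpow_of_nonneg (by positivity) ha0,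
        ENNReal.ofReal_mul (by positivity)]
      ring
    have hreal : Tendsto (fun n : ℕ => ((2 * ((n : ℝ) + 1)) ^ d) ^ a * (C / ((n : ℝ) + 1)))
        atTop (𝓝 0) := by
      have hda : (d : ℝ) * a < 1 := by simpa [ha, hd] using hq
      have heq : ∀ n : ℕ, ((2 * ((n : ℝ) + 1)) ^ d) ^ a * (C / ((n : ℝ) + 1)) =
          (2 : ℝ) ^ ((d : ℝ) * a) * C * ((n : ℝ) + 1) ^ ((d : ℝ) * a - 1) := fun n => by
        rw [← Real.rpow_natCast, ← Real.rpow_mul (by positivity),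
          Real.mul_rpow (by norm_num) (hRpos n).le, Real.rpow_sub (hRpos n), Real.rpow_one]
        field_simp
      simp_rw [heq]
      have ht : Tendsto (fun n : ℕ => ((n : ℝ) + 1) ^ ((d : ℝ) * a - 1)) atTop (𝓝 0) := by
        have h := (tendsto_rpow_neg_atTop (y := -((d : ℝ) * a - 1)) (by linarith)).comp
          (tendsto_natCast_atTop_atTop.atTop_add tendsto_const_nhds :
            Tendsto (fun n : ℕ => (n : ℝ) + 1) atTop atTop)
        simpa [neg_neg, Function.comp_def] using h
      simpa using ht.const_mul ((2 : ℝ) ^ ((d : ℝ) * a) * C)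
    have h0 := ENNReal.tendsto_ofReal hreal
    rw [ENNReal.ofReal_zero] at h0
    have h := ENNReal.Tendsto.mul_const h0 (Or.inr (ENNReal.rpow_ne_top_of_nonneg ha0 hB1.ne))
    rw [zero_mul] at h
    exact h.congr fun n => (hc_eq n).symm
  have hrhs : Tendsto (fun n : ℕ => (K : ℝ≥0∞) * (eLpNorm (fderiv ℝ u) p μ + c n * eLpNorm u q μ))
      atTop (𝓝 ((K : ℝ≥0∞) * (eLpNorm (fderiv ℝ u) p μ + 0 * eLpNorm u q μ))) :=
    ENNReal.Tendsto.const_mul (tendsto_const_nhds.add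
      (ENNReal.Tendsto.mul_const hcoef (Or.inr huq.ne))) (Or.inr ENNReal.coe_ne_top)
  calc eLpNorm u p' μ ≤ atTop.liminf fun n => eLpNorm (uR n) p' μ := hFatou
    _ ≤ atTop.liminf fun n : ℕ =>
        (K : ℝ≥0∞) * (eLpNorm (fderiv ℝ u) p μ + c n * eLpNorm u q μ) :=
        liminf_le_liminf (Eventually.of_forall hGNS)
    _ = (K : ℝ≥0∞) * (eLpNorm (fderiv ℝ u) p μ + 0 * eLpNorm u q μ) := hrhs.liminf_eq
    _ = K * eLpNorm (fderiv ℝ u) p μ := by rw [zero_mul, add_zero]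

/-- **`Ḣ¹ ∩ L^q ⊂ L⁶` in dimension three, `2 ≤ q < 6`**: every `C¹` map `u : E → F`
(`dim E = 3`, `μ` additive Haar) with `u ∈ L^q(μ)` for some `2 ≤ q < 6` satisfies
`‖u‖_{L⁶(μ)} ≤ K ‖Du‖_{L²(μ)}`, `K = SNormLESNormFDerivOfEqConst F μ 2`.
[cite: Evans2010, §5.6.1 Thm. 1–2] -/
theorem eLpNorm_six_le_of_eLpNorm_lt_top (μ : Measure E) [μ.IsAddHaarMeasure]
    (hE : Module.finrank ℝ E = 3) {u : E → F} (hu : ContDiff ℝ 1 u) {q : ℝ≥0∞} (h2q : 2 ≤ q)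
    (hq6 : q < 6) (huq : eLpNorm u q μ < ∞) :
    eLpNorm u 6 μ ≤ SNormLESNormFDerivOfEqConst F μ 2 * eLpNorm (fderiv ℝ u) 2 μ := by
  have hqt : q ≠ ⊤ := ne_top_of_lt hq6
  have hq' : (3 : ℝ) * (1 / ((2 : ℝ≥0) : ℝ) - 1 / q.toReal) < 1 := by
    have h6 : q.toReal < 6 := by
      simpa using (ENNReal.toReal_lt_toReal hqt (by norm_num)).2 hq6
    have hqpos : 0 < q.toReal := by
      have : (2 : ℝ) ≤ q.toReal := by simpa using ENNReal.toReal_mono hqt h2q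
      linarith
    have : 1 / (6 : ℝ) < 1 / q.toReal := one_div_lt_one_div_of_lt hqpos h6
    push_cast
    linarith
  exact_mod_cast eLpNorm_le_eLpNorm_fderiv_of_eq_of_eLpNorm_lt_top' μ hu (p := 2) (p' := 6)
    (q := q) one_le_two (by exact_mod_cast h2q) (by omega) (by rw [hE]; norm_num)
    (by rw [hE]; exact hq') huq

end GNS

section Steady

/-- **`L^q ∩ Ḣ¹ ⊂ L^{9/2}` on `ℝ³`, `2 ≤ q ≤ 9/2`**: a `C¹` field `u` with `u ∈ L^q`,
`∫ |Du|²_F < ∞` lies in `L^{9/2}` (`u ∈ L⁶` by `eLpNorm_six_le_of_eLpNorm_lt_top`, then Lebesgue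
interpolation `lintegral_rpow_interpolate`). [cite: RobinsonRodrigoSadowski2016, Thm. 1.5] -/
theorem memLp_nineHalves_of_memLp_of_dirichlet
    {u : EuclideanSpace ℝ (Fin 3) → EuclideanSpace ℝ (Fin 3)} (hu : ContDiff ℝ 1 u) {q : ℝ≥0∞}
    (h2q : 2 ≤ q) (hq : q ≤ 9 / 2) (huq : MemLp u q volume)
    (hD : (∫⁻ x, ENNReal.ofReal (frobeniusNormSq (fderiv ℝ u x))) < ⊤) :
    MemLp u (9 / 2 : ℝ≥0∞) volume := by
  refine ⟨hu.continuous.aestronglyMeasurable, ?_⟩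
  have h92top : (9 / 2 : ℝ≥0∞) ≠ ⊤ := by rw [Ne, ENNReal.div_eq_top]; norm_num
  have hqt : q ≠ ⊤ := ne_top_of_le_ne_top h92top hq
  have hq0 : q ≠ 0 := (lt_of_lt_of_le (by norm_num) h2q).ne'
  set r : ℝ := q.toReal with hr
  have h2r : 2 ≤ r := by simpa [hr] using ENNReal.toReal_mono hqt h2q
  have hr92 : r ≤ 9 / 2 := by simpa [hr, ENNReal.toReal_div] using ENNReal.toReal_mono h92top hq
  have hr0 : 0 < r := by linarith
  have hDu2 : eLpNorm (fderiv ℝ u) 2 volume < ⊤ := by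
    have hpt : ∀ x, ‖fderiv ℝ u x‖ₑ ^ (2 : ℝ) ≤ ENNReal.ofReal (frobeniusNormSq (fderiv ℝ u x)) :=
      fun x => by
        rw [show (2 : ℝ) = ((2 : ℕ) : ℝ) by norm_num, ENNReal.rpow_natCast,
          ← ofReal_norm, ← ENNReal.ofReal_pow (norm_nonneg _)]
        exact ENNReal.ofReal_le_ofReal ((Real.le_sqrt (norm_nonneg _)
          (frobeniusNormSq_nonneg _)).1 (opNorm_le_sqrt_frobeniusNormSq (fderiv ℝ u x)))
    rw [eLpNorm_eq_lintegral_rpow_enorm_toReal two_ne_zero ENNReal.ofNat_ne_top,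
      ENNReal.toReal_ofNat]
    exact ENNReal.rpow_lt_top_of_nonneg (by norm_num)
      (lt_top_iff_ne_top.1 (lt_of_le_of_lt (lintegral_mono hpt) hD))
  have hq6 : q < 6 := lt_of_le_of_lt hq (by
    rw [ENNReal.div_lt_iff (Or.inl two_ne_zero) (Or.inl ENNReal.ofNat_ne_top)]; norm_num)
  have hu6 : eLpNorm u 6 volume < ⊤ :=
    lt_of_le_of_lt (eLpNorm_six_le_of_eLpNorm_lt_top volume finrank_euclideanSpace_fin hu h2q hq6
      huq.2) (ENNReal.mul_lt_top ENNReal.coe_lt_top hDu2)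
  have hIq : ∫⁻ x, ‖u x‖ₑ ^ r < ⊤ := by
    have := huq.2
    rwa [eLpNorm_eq_lintegral_rpow_enorm_toReal hq0 hqt, ← hr, one_div,
      ENNReal.rpow_inv_lt_iff hr0, ENNReal.top_rpow_of_pos hr0] at this
  have hI6 : ∫⁻ x, ‖u x‖ₑ ^ (6 : ℝ) < ⊤ := by
    have := hu6
    rwa [eLpNorm_eq_lintegral_rpow_enorm_toReal (by norm_num) (by norm_num : (6 : ℝ≥0∞) ≠ ⊤),
      ENNReal.toReal_ofNat, one_div, ENNReal.rpow_inv_lt_iff (by norm_num : (0 : ℝ) < 6),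
      ENNReal.top_rpow_of_pos (by norm_num : (0 : ℝ) < 6)] at this
  have h92real : (9 / 2 : ℝ≥0∞).toReal = 9 / 2 := by rw [ENNReal.toReal_div]; norm_num
  rw [eLpNorm_eq_lintegral_rpow_enorm_toReal (by norm_num) h92top, h92real]
  refine ENNReal.rpow_lt_top_of_nonneg (by norm_num) (lt_top_iff_ne_top.1 ?_)
  rcases eq_or_lt_of_le hr92 with hreq | hrlt
  · rw [← hreq]; exact hIq
  · refine lt_of_le_of_lt (lintegral_rpow_interpolate hu.continuous.aestronglyMeasurable.enorm
      hr0 (by linarith : r < 6)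
      (le_of_lt hrlt) (by norm_num : (9 / 2 : ℝ) ≤ 6)) (ENNReal.mul_lt_top ?_ ?_)
    · exact ENNReal.rpow_lt_top_of_nonneg (div_nonneg (by norm_num) (by linarith)) hIq.ne
    · exact ENNReal.rpow_lt_top_of_nonneg (div_nonneg (by linarith) (by linarith)) hI6.ne

/-- **Rescaling a steady solution to unit viscosity**: if `(U, P)` solves
`−νΔU + (U·∇)U + ∇P = 0`, `div U = 0` (`IsLerayProfile ν 0 U P`, `ν ≠ 0`) then `(ν⁻¹U, ν⁻²P)`
solves it with `ν = 1` (each term picks up `ν⁻²`).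
[cite: Galdi2011, Thm X.9.5 (normalisation ν = 1)] -/
theorem IsLerayProfile.inv_smul_viscosity {E : Type*} [NormedAddCommGroup E]
    [InnerProductSpace ℝ E] [FiniteDimensional ℝ E] {ν : ℝ} (hν : ν ≠ 0) {U : E → E} {P : E → ℝ}
    (h : IsLerayProfile ν 0 U P) :
    IsLerayProfile 1 0 (fun x => ν⁻¹ • U x) (fun x => ν⁻¹ ^ 2 • P x) := by
  have hU2 : ContDiff ℝ 2 U := h.contDiff_velocity
  have hUd : ∀ x, DifferentiableAt ℝ U x := fun x => (hU2.differentiable (by simp)) x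
  refine ⟨hU2.const_smul ν⁻¹, h.contDiff_pressure.const_smul (ν⁻¹ ^ 2), fun y => ?_,
    h.divFree.const_smul (hU2.differentiable (by simp)) ν⁻¹⟩
  have hfd : fderiv ℝ (fun x => ν⁻¹ • U x) y = ν⁻¹ • fderiv ℝ U y :=
    fderiv_fun_const_smul (hUd y) ν⁻¹
  have hconv : convect (fun x => ν⁻¹ • U x) (fun x => ν⁻¹ • U x) y = ν⁻¹ ^ 2 • convect U U y := by
    simp only [convect_apply, hfd, FunLike.coe_smul, Pi.smul_apply, map_smul, smul_smul, sq]
  have hΔ : (Δ fun x => ν⁻¹ • U x) y = ν⁻¹ • (Δ U) y :=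
    InnerProductSpace.laplacian_smul ν⁻¹ hU2.contDiffAt
  have key := h.profile_eq y
  simp only [zero_smul, add_zero] at key
  rw [hΔ, hconv, gradient_const_smul ((h.contDiff_pressure.differentiable one_ne_zero) y) _,
    one_smul, zero_smul, zero_smul, add_zero, add_zero]
  have e : ν⁻¹ • (Δ U) y = ν⁻¹ ^ 2 • (ν • (Δ U) y) := by
    rw [smul_smul]; congr 1; field_simp
  rw [e, ← smul_neg, ← smul_add, ← smul_add, key, smul_zero]

/-- **Galdi's `L^{9/2}` Liouville theorem, Dirichlet integral in place of decay, every `ν > 0`**: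
a `C²` steady solution of `−νΔU + (U·∇)U + ∇P = 0`, `div U = 0` on `ℝ³` with `∫ |∇U|²_F < ∞` and
`U ∈ L^{9/2}` is `≡ 0` (rescale to `ν = 1`; `SteadyLiouvilleL9half.integral_gradSq_eq_zero` gives
`∇U ≡ 0`; a constant in `L^{9/2}(ℝ³)` vanishes as `vol ℝ³ = ∞`). [cite: Galdi2011, Thm X.9.5] -/
theorem steadyNS_eq_zero_of_memLp_nineHalves_of_dirichlet {ν : ℝ} (hν : 0 < ν)
    {U : EuclideanSpace ℝ (Fin 3) → EuclideanSpace ℝ (Fin 3)} {P : EuclideanSpace ℝ (Fin 3) → ℝ}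
    (hprof : IsLerayProfile ν 0 U P)
    (hD : (∫⁻ x, ENNReal.ofReal (frobeniusNormSq (fderiv ℝ U x))) < ⊤)
    (hLp : MemLp U (9 / 2 : ℝ≥0∞) volume) : U = 0 := by
  set W : EuclideanSpace ℝ (Fin 3) → EuclideanSpace ℝ (Fin 3) := fun x => ν⁻¹ • U x with hW
  have hprof1 : IsLerayProfile 1 0 W (fun x => ν⁻¹ ^ 2 • P x) := hprof.inv_smul_viscosity hν.ne'
  have hWinf : ContDiff ℝ (⊤ : ℕ∞) W := hprof1.contDiff_velocity_infty one_ne_zero (by simp)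
  have hfdW : ∀ x, fderiv ℝ W x = ν⁻¹ • fderiv ℝ U x := fun x =>
    fderiv_fun_const_smul ((hprof.contDiff_velocity.differentiable (by simp)) x) ν⁻¹
  have hDW : (∫⁻ x, ENNReal.ofReal (frobeniusNormSq (fderiv ℝ W x))) < ⊤ := by
    have heq : ∀ x, ENNReal.ofReal (frobeniusNormSq (fderiv ℝ W x)) =
        ENNReal.ofReal (ν⁻¹ ^ 2) * ENNReal.ofReal (frobeniusNormSq (fderiv ℝ U x)) := fun x => by
      rw [hfdW x, frobeniusNormSq_const_smul, ENNReal.ofReal_mul (sq_nonneg _)]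
    simp_rw [heq]
    rw [lintegral_const_mul' _ _ ENNReal.ofReal_ne_top]
    exact ENNReal.mul_lt_top ENNReal.ofReal_lt_top hD
  have hLpW : MemLp W (9 / 2 : ℝ≥0∞) volume := hLp.const_smul ν⁻¹
  -- Galdi at `ν = 1`: the Dirichlet integral of `W` vanishes, so `DW ≡ 0` and `W` is constant
  have hDint : Integrable (SteadyLiouvilleL9half.gradSq W) :=
    SteadyLiouvilleL9half.integrable_gradSq hWinf hDW
  have hae : SteadyLiouvilleL9half.gradSq W =ᵐ[volume] 0 :=
    (integral_eq_zero_iff_of_nonneg (fun x => SteadyLiouvilleL9half.gradSq_nonneg W x) hDint).1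
      (SteadyLiouvilleL9half.integral_gradSq_eq_zero hprof1 hWinf hLpW hDint)
  have hfun : SteadyLiouvilleL9half.gradSq W = 0 :=
    ((SteadyLiouvilleL9half.continuous_gradSq hWinf).ae_eq_iff_eq volume continuous_const).1 hae
  have hconst : ∀ x, W x = W 0 := fun x =>
    is_const_of_fderiv_eq_zero (hWinf.differentiable (by simp))
      (fun x => SteadyLiouvilleL9half.fderiv_eq_zero_of_gradSq_eq_zero hWinf (congrFun hfun x)) x 0
  -- a constant in `L^{9/2}(ℝ³)` is `0`
  have hW0 : W 0 = 0 := by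
    have h92top : (9 / 2 : ℝ≥0∞) ≠ ⊤ := by rw [Ne, ENNReal.div_eq_top]; norm_num
    rcases (memLp_const_iff (by norm_num) h92top).1 (hLpW.ae_eq (Eventually.of_forall hconst))
      with h0 | hfin
    · exact h0
    · exact absurd
        (measure_univ_of_isAddLeftInvariant (volume : Measure (EuclideanSpace ℝ (Fin 3)))) hfin.ne
  funext x
  have : U x = ν • W x := by
    rw [hW]; simp only [smul_smul, mul_inv_cancel₀ hν.ne', one_smul]
  rw [this, hconst x, hW0, smul_zero]
  rfl

/-- **Steady Navier–Stokes solutions in `L^q ∩ Ḣ¹(ℝ³)`, `2 ≤ q ≤ 9/2`, are trivial** — the last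
sentence of the proof of Chae 2010, Thm. 1.4 ("in the case `V̄ ∈ Ḣ¹ ∩ L^p` we easily obtain
`∫|∇V̄|² = 0`, which implies `V̄ = 0`") in its provable range: for `ν > 0`, a `C²` solution of
`−νΔU + (U·∇)U + ∇P = 0`, `div U = 0` on `ℝ³` (`IsLerayProfile ν 0 U P`) with `U ∈ L^q` for some
`2 ≤ q ≤ 9/2` and `∫ |∇U|²_F < ∞` is `≡ 0`. For `q > 9/2` no such statement is known (Liouville
problem for D-solutions, `SteadyDSolutionLiouvilleProblem`).
[cite: Galdi2011, Thm X.9.5] [cite: Chae2010, Thm 1.4 (proof, last sentence, p. 6)] -/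
theorem steadyNS_eq_zero_of_memLp_of_dirichlet {ν : ℝ} (hν : 0 < ν)
    {U : EuclideanSpace ℝ (Fin 3) → EuclideanSpace ℝ (Fin 3)} {P : EuclideanSpace ℝ (Fin 3) → ℝ}
    (hprof : IsLerayProfile ν 0 U P) {q : ℝ≥0∞} (h2q : 2 ≤ q) (hq : q ≤ 9 / 2)
    (hLq : MemLp U q volume)
    (hD : (∫⁻ x, ENNReal.ofReal (frobeniusNormSq (fderiv ℝ U x))) < ⊤) : U = 0 :=
  steadyNS_eq_zero_of_memLp_nineHalves_of_dirichlet hν hprof hD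
    (memLp_nineHalves_of_memLp_of_dirichlet (hprof.contDiff_velocity.of_le one_le_two) h2q hq
      hLq hD)

end Steady
end Literature.Analysis.FluidPDE

end
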